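import Summits.SmoothPoincare4.SmoothPoincare4.Theorems.CylinderEntropyImmortalAreaToFloorCutPieceTerms
import HarnessLib

/-!
# Route `CylinderEntropy`, item `ImmortalAreaToFloor` (stmt-SmoothPoincare4-17197):
# the weighted Gaussian density of a height-cut piece across scales (module Γ6b of
# `BLUEPRINT-17197-c2.md`, part 3)

For a closed immersed cross-section `f : M⁴ → N ⊂ ℝ⁶` with smooth unit normal `ν` tangent to `N`,
mean curvature `H`, a centre `x₀`, a height cutoff `u ∈ C²(ℝ)` (`0 ≤ u ≤ 1`, `|u'| ≤ c₁/g`,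
`|u''| ≤ c₂/g²`, `u = 1` on heights within `g/3` of `x₀`), two scales `0 < σ₀ ≤ σ₁` and a near radius
`ρ ≥ 0`, the theorem `cutPiece_twoScale` bounds the `u`-weighted Gaussian density at the LARGE scale
`σ₁` from below by the unweighted density at the SMALL scale `σ₀`, up to an explicit error built from:
the Gaussian-weighted Willmore bound `∫ G_s H² ≤ K_H` (`s ∈ [σ₀, σ₁]`), the Gaussian mass bound
`∫ G_s ≤ C` (`s ∈ [σ₀, 4σ₁]`), the near tilt `∫_{‖f-x₀‖≤ρ} |ν'|² ≤ T` and the near mass `≤ A`: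
`e^{4σ₀}(∫ G_{σ₀} - 4e^{-g²/(72σ₀)} ∫ G_{2σ₀}) ≤ e^{4σ₁} ∫ u G_{σ₁} + e^{4σ₁} K⋆ (σ₁ - σ₀)`, with
`K⋆ = K_H/4 + (c₂/g²)((4πσ₀)⁻² T + 4e^{-ρ²/(8σ₁)} C) + (c₁/g)((λ/2) K_H + C/(2λ))`
`     + (1/σ₀)(c₁/g)((4πσ₀)⁻² ρ ((κ/2) T + A/(2κ)) + 32 √σ₁ e^{-1/2} e^{-ρ²/(16σ₁)} C)`
(`λ, κ > 0` free).  It is the landed `weightedTwoScaleMonotonicity` fed with the landed term bounds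
(`cutoffError_slab_le`, `cutoffError_transport_le`, monotone in the scale) and the landed
initial-scale lemma `weightedDensity_initial_ge`.  In the stacking argument (`x₀ = x₁` a good point,
`σ₀ = g²/C₀²`, `σ₁ = Λ₁ g²`, `ρ = K_ρ g`, `T = ξ A`, `A ≍ ρ⁴`) every contribution to `K⋆ σ₁` is either
scale-free and proportional to `ξ`, `√ξ`, `e^{-K_ρ²/(16Λ₁)}`, or carries a factor `g`.

References: W. K. Allard, Ann. of Math. 95 (1972) §6; L. Simon, *Lectures on GMT* (1983) §17.
-/

-- the prescribed namespace `Summit.SmoothPoincare4.SmoothPoincare4.…` repeats `SmoothPoincare4`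
set_option linter.dupNamespace false

noncomputable section

open Bundle Set Function Filter MeasureTheory Module
open scoped Manifold ContDiff Topology RealInnerProductSpace BigOperators

namespace Summit.SmoothPoincare4.SmoothPoincare4.Cruxes.CylinderRungTwo.KillingFlux

open Literature.Geometry.Riemannian Literature.Geometry.Riemannian.EuclideanHypersurface
open Literature.Geometry.Lorentzian Literature.Geometry.Lorentzian.PseudoRiemannianMetric
open Summit.SmoothPoincare4.SmoothPoincare4.Theorems.GaussianBounds

section TwoScale

variable {M : Type*} [TopologicalSpace M] [ChartedSpace (EuclideanSpace ℝ (Fin 4)) M]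
  [IsManifold (𝓡 4) ∞ M] [CompactSpace M] [T2Space M] [MeasurableSpace M] [BorelSpace M]

/-- Elementary monotonicity facts in the scale used to make the cutoff-error bound uniform on
`[σ₀, σ₁]`: `(4πs)⁻² ≤ (4πσ₀)⁻²`, `1/s ≤ 1/σ₀`, `√s ≤ √σ₁`, `e^{-a/(8s)} ≤ e^{-a/(8σ₁)}`,
`e^{-a/(16s)} ≤ e^{-a/(16σ₁)}` for `σ₀ ≤ s ≤ σ₁`, `a ≥ 0`. [folklore] -/
theorem scale_monotonicity_facts {σ₀ σ₁ s a : ℝ} (hσ₀ : 0 < σ₀) (hs : s ∈ Set.Icc σ₀ σ₁) (ha : 0 ≤ a) :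
    1 / (4 * Real.pi * s) ^ 2 ≤ 1 / (4 * Real.pi * σ₀) ^ 2 ∧ 1 / s ≤ 1 / σ₀ ∧
      Real.sqrt s ≤ Real.sqrt σ₁ ∧ Real.exp (-a / (8 * s)) ≤ Real.exp (-a / (8 * σ₁)) ∧
      Real.exp (-a / (16 * s)) ≤ Real.exp (-a / (16 * σ₁)) := by
  have hπ := Real.pi_pos
  have hs0 : 0 < s := lt_of_lt_of_le hσ₀ hs.1
  refine ⟨?_, ?_, Real.sqrt_le_sqrt hs.2, ?_, ?_⟩
  · apply div_le_div_of_nonneg_left zero_le_one (by positivity)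
    exact pow_le_pow_left₀ (by positivity) (mul_le_mul_of_nonneg_left hs.1 (by positivity)) 2
  · exact div_le_div_of_nonneg_left zero_le_one hσ₀ hs.1
  · apply Real.exp_le_exp.2
    rw [neg_div, neg_div, neg_le_neg_iff]
    exact div_le_div_of_nonneg_left ha (by positivity) (by linarith [hs.2])
  · apply Real.exp_le_exp.2
    rw [neg_div, neg_div, neg_le_neg_iff]
    exact div_le_div_of_nonneg_left ha (by positivity) (by linarith [hs.2])

/-- **The weighted Gaussian density of a height-cut piece across scales.**  See the module
docstring for the statement; hypotheses: `hH` the Gaussian-weighted Willmore bound on `[σ₀, σ₁]`,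
`hC` the Gaussian mass bound on `[σ₀, 4σ₁]`, `hT`/`hA` the near tilt / mass at radius `ρ`, `u` the
cutoff.  Proof: `weightedTwoScaleMonotonicity` with the constant `K⋆`, whose hypothesis on each
scale `s ∈ [σ₀, σ₁]` is the sum of `¼ ∫ u G_s H² ≤ ¼ K_H`, `cutoffError_slab_le` and
`cutoffError_transport_le`, made uniform in `s` by `scale_monotonicity_facts`; then
`weightedDensity_initial_ge` at `σ₀`. [cite: Allard1972, §6] -/
theorem cutPiece_twoScale {f νf : M → EuclideanSpace ℝ (Fin 6)}
    (hf : (euclideanMetric (EuclideanSpace ℝ (Fin 6))).IsSpacelikeImmersion (𝓡 4) f)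
    (hν : ContMDiff (𝓡 4) 𝓘(ℝ, EuclideanSpace ℝ (Fin 6)) ∞ νf)
    (hun : (euclideanMetric (EuclideanSpace ℝ (Fin 6))).IsUnitNormal (𝓡 4) f νf 1)
    (hN : ∀ x, ∑ i : Fin 5, f x (Fin.castSucc i) ^ 2 = 1)
    (hνN : ∀ x, ∑ i : Fin 5, νf x (Fin.castSucc i) * f x (Fin.castSucc i) = 0)
    (x₀ : EuclideanSpace ℝ (Fin 6)) {σ₀ σ₁ ρ g c₁ c₂ lam κ T A KH C : ℝ}
    (hσ₀ : 0 < σ₀) (hσ : σ₀ ≤ σ₁) (hρ : 0 ≤ ρ) (hg : 0 < g) (hlam : 0 < lam) (hκ : 0 < κ)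
    {u : ℝ → ℝ} (hu : ContDiff ℝ 2 u) (hu01 : ∀ t, 0 ≤ u t ∧ u t ≤ 1)
    (hu1 : ∀ t, |deriv u t| ≤ c₁ / g) (hu2 : ∀ t, |deriv (deriv u) t| ≤ c₂ / g ^ 2)
    (hufar : ∀ t, |t - x₀ 5| < g / 3 → u t = 1)
    (hH : ∀ s ∈ Set.Icc σ₀ σ₁,
      ∫ w, (Real.exp (-‖f w - x₀‖ ^ 2 / (4 * s)) / (4 * Real.pi * s) ^ 2) *
          (euclideanMetric (EuclideanSpace ℝ (Fin 6))).meanCurvature f contMDiff_pullbackBilin_holds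
            hf νf w ^ 2
        ∂riemannianMeasure ((euclideanMetric (EuclideanSpace ℝ (Fin 6))).inducedRiemannianMetric f
          contMDiff_pullbackBilin_holds hf) ≤ KH)
    (hC : ∀ s ∈ Set.Icc σ₀ (4 * σ₁),
      ∫ w, Real.exp (-‖f w - x₀‖ ^ 2 / (4 * s)) / (4 * Real.pi * s) ^ 2
        ∂riemannianMeasure ((euclideanMetric (EuclideanSpace ℝ (Fin 6))).inducedRiemannianMetric f
          contMDiff_pullbackBilin_holds hf) ≤ C)
    (hT : ∫ w in f ⁻¹' Metric.closedBall x₀ ρ, (∑ i : Fin 5, νf w (Fin.castSucc i) ^ 2)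
      ∂riemannianMeasure ((euclideanMetric (EuclideanSpace ℝ (Fin 6))).inducedRiemannianMetric f
        contMDiff_pullbackBilin_holds hf) ≤ T)
    (hA : (riemannianMeasure ((euclideanMetric (EuclideanSpace ℝ (Fin 6))).inducedRiemannianMetric f
        contMDiff_pullbackBilin_holds hf)).real (f ⁻¹' Metric.closedBall x₀ ρ) ≤ A) :
    Real.exp (4 * σ₀) *
        (∫ w, Real.exp (-‖f w - x₀‖ ^ 2 / (4 * σ₀)) / (4 * Real.pi * σ₀) ^ 2
            ∂riemannianMeasure ((euclideanMetric (EuclideanSpace ℝ (Fin 6))).inducedRiemannianMetric f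
              contMDiff_pullbackBilin_holds hf)
          - 4 * Real.exp (-g ^ 2 / (72 * σ₀)) *
            ∫ w, Real.exp (-‖f w - x₀‖ ^ 2 / (4 * (2 * σ₀))) / (4 * Real.pi * (2 * σ₀)) ^ 2
              ∂riemannianMeasure ((euclideanMetric (EuclideanSpace ℝ (Fin 6))).inducedRiemannianMetric f
                contMDiff_pullbackBilin_holds hf)) ≤
      Real.exp (4 * σ₁) *
          ∫ w, u (f w 5) * (Real.exp (-‖f w - x₀‖ ^ 2 / (4 * σ₁)) / (4 * Real.pi * σ₁) ^ 2)
            ∂riemannianMeasure ((euclideanMetric (EuclideanSpace ℝ (Fin 6))).inducedRiemannianMetric f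
              contMDiff_pullbackBilin_holds hf)
        + Real.exp (4 * σ₁) *
          (KH / 4
            + c₂ / g ^ 2 * ((1 / (4 * Real.pi * σ₀) ^ 2) * T + 4 * Real.exp (-ρ ^ 2 / (8 * σ₁)) * C)
            + c₁ / g * ((lam / 2) * KH + (1 / (2 * lam)) * C)
            + (1 / σ₀) * (c₁ / g * ((1 / (4 * Real.pi * σ₀) ^ 2) * ρ * ((κ / 2) * T + A / (2 * κ))
              + 32 * Real.sqrt σ₁ * Real.exp (-(1 / 2)) * Real.exp (-ρ ^ 2 / (16 * σ₁)) * C)))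
          * (σ₁ - σ₀) := by
  set g₁ := (euclideanMetric (EuclideanSpace ℝ (Fin 6))).inducedRiemannianMetric f
    contMDiff_pullbackBilin_holds hf with hg₁
  set μ := riemannianMeasure g₁ with hμ
  set Hm : M → ℝ := fun w => (euclideanMetric (EuclideanSpace ℝ (Fin 6))).meanCurvature f
    contMDiff_pullbackBilin_holds hf νf w with hHm
  have hπ := Real.pi_pos
  have hσ₁ : 0 < σ₁ := lt_of_lt_of_le hσ₀ hσ
  -- signs of the data
  have hS0 : ∀ w, 0 ≤ ∑ i : Fin 5, νf w (Fin.castSucc i) ^ 2 :=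
    fun w => Finset.sum_nonneg fun i _ => sq_nonneg _
  have hT0 : 0 ≤ T := le_trans (setIntegral_nonneg
    ((Metric.isClosed_closedBall.preimage hf.contMDiff_self.continuous).measurableSet)
    fun w _ => hS0 w) hT
  have hA0 : 0 ≤ A := le_trans measureReal_nonneg hA
  have hKH0 : 0 ≤ KH := le_trans (integral_nonneg fun w => mul_nonneg
    (gaussianWeight_comp_nonneg f x₀ w) (sq_nonneg _)) (hH σ₀ ⟨le_rfl, hσ⟩)
  have hC0 : 0 ≤ C := le_trans (integral_nonneg fun w => gaussianWeight_comp_nonneg f x₀ w)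
    (hC σ₀ ⟨le_rfl, by linarith⟩)
  have hc₁ : 0 ≤ c₁ / g := le_trans (abs_nonneg _) (hu1 0)
  have hc₂ : 0 ≤ c₂ / g ^ 2 := le_trans (abs_nonneg _) (hu2 0)
  have hu0 : ∀ t, 0 ≤ u t := fun t => (hu01 t).1
  have hρ2 : 0 ≤ ρ ^ 2 := sq_nonneg _
  -- the pieces of the constant and their signs
  set K1 : ℝ := c₂ / g ^ 2 * ((1 / (4 * Real.pi * σ₀) ^ 2) * T + 4 * Real.exp (-ρ ^ 2 / (8 * σ₁)) * C)
    with hK1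
  set K2 : ℝ := c₁ / g * ((lam / 2) * KH + (1 / (2 * lam)) * C) with hK2
  set K3 : ℝ := (1 / σ₀) * (c₁ / g * ((1 / (4 * Real.pi * σ₀) ^ 2) * ρ * ((κ / 2) * T + A / (2 * κ))
      + 32 * Real.sqrt σ₁ * Real.exp (-(1 / 2)) * Real.exp (-ρ ^ 2 / (16 * σ₁)) * C)) with hK3
  have hK10 : 0 ≤ K1 := by positivity
  have hK20 : 0 ≤ K2 := by positivity
  have hK30 : 0 ≤ K3 := by positivity
  have hKst0 : 0 ≤ KH / 4 + K1 + K2 + K3 := by positivity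
  -- the error functional on each scale
  have herr : ∀ s ∈ Set.Icc σ₀ σ₁,
      (1 / 4) * ∫ w, u (f w 5) * (Real.exp (-‖f w - x₀‖ ^ 2 / (4 * s)) / (4 * Real.pi * s) ^ 2) *
            Hm w ^ 2 ∂μ
        + ∫ w, (Real.exp (-‖f w - x₀‖ ^ 2 / (4 * s)) / (4 * Real.pi * s) ^ 2) *
            (deriv (deriv u) (f w 5) * (1 - νf w 5 ^ 2) - Hm w * (deriv u (f w 5) * νf w 5)) ∂μ
        - (1 / s) * ∫ w, deriv u (f w 5) * (Real.exp (-‖f w - x₀‖ ^ 2 / (4 * s)) / (4 * Real.pi * s) ^ 2) *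
            ((f w - x₀) 5 - νf w 5 * ⟪f w - x₀, νf w⟫) ∂μ
        ≤ KH / 4 + K1 + K2 + K3 := by
    intro s hs
    have hs0 : 0 < s := lt_of_lt_of_le hσ₀ hs.1
    obtain ⟨hinv, h1s, hsqrt, hexp8, hexp16⟩ := scale_monotonicity_facts (a := ρ ^ 2) hσ₀ hs hρ2
    -- the integrals entering the bounds
    set I1 : ℝ := ∫ w, Real.exp (-‖f w - x₀‖ ^ 2 / (4 * s)) / (4 * Real.pi * s) ^ 2 ∂μ with hI1
    set I2 : ℝ := ∫ w, Real.exp (-‖f w - x₀‖ ^ 2 / (4 * (2 * s))) / (4 * Real.pi * (2 * s)) ^ 2 ∂μ with hI2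
    set I4 : ℝ := ∫ w, Real.exp (-‖f w - x₀‖ ^ 2 / (4 * (4 * s))) / (4 * Real.pi * (4 * s)) ^ 2 ∂μ with hI4
    set IH : ℝ := ∫ w, (Real.exp (-‖f w - x₀‖ ^ 2 / (4 * s)) / (4 * Real.pi * s) ^ 2) * Hm w ^ 2 ∂μ
      with hIH
    have hI1C : I1 ≤ C := hC s ⟨hs.1, by linarith [hs.2]⟩
    have hI2C : I2 ≤ C := hC (2 * s) ⟨by linarith [hs.1], by linarith [hs.2]⟩
    have hI4C : I4 ≤ C := hC (4 * s) ⟨by linarith [hs.1], by linarith [hs.2]⟩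
    have hIHK : IH ≤ KH := hH s hs
    have hI20 : 0 ≤ I2 := integral_nonneg fun w => gaussianWeight_comp_nonneg f x₀ w
    have hI40 : 0 ≤ I4 := integral_nonneg fun w => gaussianWeight_comp_nonneg f x₀ w
    -- term A: `¼ ∫ u G H² ≤ ¼ K_H`
    have hAterm : (1 / 4) * ∫ w, u (f w 5) * (Real.exp (-‖f w - x₀‖ ^ 2 / (4 * s)) /
        (4 * Real.pi * s) ^ 2) * Hm w ^ 2 ∂μ ≤ KH / 4 := by
      have h1 : ∫ w, u (f w 5) * (Real.exp (-‖f w - x₀‖ ^ 2 / (4 * s)) / (4 * Real.pi * s) ^ 2) *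
          Hm w ^ 2 ∂μ ≤ IH := by
        have hfc : Continuous f := hf.contMDiff_self.continuous
        have h5c : Continuous fun w => f w 5 :=
          (EuclideanSpace.proj (5 : Fin 6) : EuclideanSpace ℝ (Fin 6) →L[ℝ] ℝ).continuous.comp hfc
        have hGc := continuous_gaussianWeight_comp hf x₀ s
        have hHc : Continuous Hm := continuous_meanCurvature_euclidean hf hν
        refine integral_mono (integrable_of_continuous (h := g₁) (((hu.continuous.comp h5c).mul hGc).mul
          (hHc.pow 2))) (integrable_of_continuous (h := g₁) (hGc.mul (hHc.pow 2))) fun w => ?_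
        have hGH : 0 ≤ (Real.exp (-‖f w - x₀‖ ^ 2 / (4 * s)) / (4 * Real.pi * s) ^ 2) * Hm w ^ 2 :=
          mul_nonneg (gaussianWeight_comp_nonneg f x₀ w) (sq_nonneg _)
        calc u (f w 5) * (Real.exp (-‖f w - x₀‖ ^ 2 / (4 * s)) / (4 * Real.pi * s) ^ 2) * Hm w ^ 2
            = u (f w 5) * ((Real.exp (-‖f w - x₀‖ ^ 2 / (4 * s)) / (4 * Real.pi * s) ^ 2) * Hm w ^ 2) := by
              ring
          _ ≤ 1 * ((Real.exp (-‖f w - x₀‖ ^ 2 / (4 * s)) / (4 * Real.pi * s) ^ 2) * Hm w ^ 2) :=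
              mul_le_mul_of_nonneg_right (hu01 _).2 hGH
          _ = _ := one_mul _
      linarith
    -- terms B+C and D from the landed lemmas
    have hBterm := cutoffError_slab_le hf hν hun x₀ hs0 hρ hlam hu hu1 hu2 hT
    have hDterm := cutoffError_transport_le hf hν hun x₀ hs0 hρ hκ hu hu1 hT hA
    -- uniformity in the scale
    have hB' : c₂ / g ^ 2 * ((1 / (4 * Real.pi * s) ^ 2) * T + 4 * Real.exp (-ρ ^ 2 / (8 * s)) * I2)
        + c₁ / g * ((lam / 2) * IH + (1 / (2 * lam)) * I1) ≤ K1 + K2 := by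
      have e1 : (1 / (4 * Real.pi * s) ^ 2) * T ≤ (1 / (4 * Real.pi * σ₀) ^ 2) * T :=
        mul_le_mul_of_nonneg_right hinv hT0
      have e2 : 4 * Real.exp (-ρ ^ 2 / (8 * s)) * I2 ≤ 4 * Real.exp (-ρ ^ 2 / (8 * σ₁)) * C :=
        mul_le_mul (mul_le_mul_of_nonneg_left hexp8 (by norm_num)) hI2C hI20 (by positivity)
      have e3 : (lam / 2) * IH ≤ (lam / 2) * KH := mul_le_mul_of_nonneg_left hIHK (by positivity)
      have e4 : (1 / (2 * lam)) * I1 ≤ (1 / (2 * lam)) * C := mul_le_mul_of_nonneg_left hI1C (by positivity)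
      have := add_le_add (mul_le_mul_of_nonneg_left (add_le_add e1 e2) hc₂)
        (mul_le_mul_of_nonneg_left (add_le_add e3 e4) hc₁)
      simp only [hK1, hK2]
      linarith
    have hD' : (1 / s) * (c₁ / g * ((1 / (4 * Real.pi * s) ^ 2) * ρ * ((κ / 2) * T + A / (2 * κ)) +
        32 * Real.sqrt s * Real.exp (-(1 / 2)) * Real.exp (-ρ ^ 2 / (16 * s)) * I4)) ≤ K3 := by
      have hbr0 : 0 ≤ (κ / 2) * T + A / (2 * κ) := by positivity
      have e1 : (1 / (4 * Real.pi * s) ^ 2) * ρ * ((κ / 2) * T + A / (2 * κ)) ≤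
          (1 / (4 * Real.pi * σ₀) ^ 2) * ρ * ((κ / 2) * T + A / (2 * κ)) :=
        mul_le_mul_of_nonneg_right (mul_le_mul_of_nonneg_right hinv hρ) hbr0
      have e2 : 32 * Real.sqrt s * Real.exp (-(1 / 2)) * Real.exp (-ρ ^ 2 / (16 * s)) * I4 ≤
          32 * Real.sqrt σ₁ * Real.exp (-(1 / 2)) * Real.exp (-ρ ^ 2 / (16 * σ₁)) * C := by
        refine mul_le_mul ?_ hI4C hI40 (by positivity)
        exact mul_le_mul (mul_le_mul_of_nonneg_right (mul_le_mul_of_nonneg_left hsqrt (by norm_num))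
          (Real.exp_pos _).le) hexp16 (Real.exp_pos _).le (by positivity)
      have hin := mul_le_mul_of_nonneg_left (add_le_add e1 e2) hc₁
      have hin0 : 0 ≤ c₁ / g * ((1 / (4 * Real.pi * s) ^ 2) * ρ * ((κ / 2) * T + A / (2 * κ)) +
          32 * Real.sqrt s * Real.exp (-(1 / 2)) * Real.exp (-ρ ^ 2 / (16 * s)) * I4) := by positivity
      simp only [hK3]
      calc (1 / s) * _ ≤ (1 / σ₀) * (c₁ / g * ((1 / (4 * Real.pi * s) ^ 2) * ρ * ((κ / 2) * T + A / (2 * κ)) +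
            32 * Real.sqrt s * Real.exp (-(1 / 2)) * Real.exp (-ρ ^ 2 / (16 * s)) * I4)) :=
            mul_le_mul_of_nonneg_right h1s hin0
        _ ≤ _ := mul_le_mul_of_nonneg_left hin (by positivity)
    linarith [hBterm, hDterm, hB', hD', hAterm]
  -- the weighted two-scale monotonicity
  have hmono := weightedTwoScaleMonotonicity hf hν hun hN hνN x₀ hσ₀ hσ hu hu0 hKst0 herr
  -- the initial scale
  have hinit := weightedDensity_initial_ge hf x₀ hσ₀ hg hu.continuous hu01 hufar
  have hexp0 : 0 < Real.exp (4 * σ₀) := Real.exp_pos _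
  have h1 := mul_le_mul_of_nonneg_left hinit hexp0.le
  rw [← hg₁, ← hμ] at hmono h1
  linarith [hmono, h1]

end TwoScale

end Summit.SmoothPoincare4.SmoothPoincare4.Cruxes.CylinderRungTwo.KillingFlux

end
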